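import Summits.KontsevichZagierPeriods.KontsevichZagierPeriods.Theorems.SoloInformedAlgFiniteZeros
import Mathlib.RingTheory.Polynomial.GaussLemma
import Mathlib.RingTheory.Polynomial.Resultant.Basic
import HarnessLib

/-!
# The DEN-calculus over `K`: elimination — common zeros of coprime plane curves are finite

Solo programme `solo-KontsevichZagierPeriods-informed`, session s108, step 3 of THEOREM 2D⁺
(pure algebra).

* `soloInformedBivΨ` — `K[x₀, x₁] ≃ₐ[K] (K[x₁])[x₀]`, with the evaluation formula
  `soloInformed_bivEvalR_Ψ`;
* **ELIM** `soloInformed_elim_snd` / `soloInformed_elim_fst` — for `F` irreducible and `F ∤ G`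
  there is a non-zero `d ∈ K[t]` vanishing at the second (resp. first) coordinate of every common
  real zero of `F` and `G`: if `deg_{x₀} F = 0` take `d = F` itself; otherwise `F` is primitive
  over `K[x₁]`, stays irreducible over `K(x₁)` (Gauss), does not divide `G` there (Gauss), so
  `F, G` are coprime over `K(x₁)` and `d = Res_{x₀}(F, G) ≠ 0`, while `F·p + G·q = d`;
* `soloInformed_finite_commonZeros` — hence the common real zero set of `F` and `G` is finite.

References: Bochnak–Coste–Roy 1998 §1.2 (resultants); Gauss's lemma (Mathlib
`Polynomial.IsPrimitive.irreducible_iff_irreducible_map_fraction_map`).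
-/

noncomputable section

open scoped BigOperators Polynomial
open Set

namespace Summit.KontsevichZagierPeriods.KontsevichZagierPeriods.Theorems

variable {K : Type*} [Field K] [Algebra K ℝ]

/-! ## `K[x₀, x₁]` as `(K[x₁])[x₀]` -/

variable (K) in
/-- The algebra isomorphism `K[x₀, x₁] ≃ (K[x₁])[x₀]`: the outer variable is `x₀`, the
coefficients are polynomials in `x₁`. -/
def soloInformedBivΨ : MvPolynomial (Fin 2) K ≃ₐ[K] (K[X])[X] :=
  (MvPolynomial.finSuccEquiv K 1).trans (Polynomial.mapAlgEquiv (MvPolynomial.uniqueAlgEquiv K (Fin 1)))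

/-- Evaluation of an element of `(K[x₁])[x₀]` at a real point `x`: inner variable at `x 1`, outer
variable at `x 0`. -/
def soloInformedBivEvalR (x : Fin 2 → ℝ) : (K[X])[X] →+* ℝ :=
  Polynomial.eval₂RingHom (Polynomial.eval₂RingHom (algebraMap K ℝ) (x 1)) (x 0)

/-- Evaluation of a constant (a polynomial in `x₁` alone). -/
theorem soloInformed_bivEvalR_C (x : Fin 2 → ℝ) (d : K[X]) :
    soloInformedBivEvalR x (Polynomial.C d) = Polynomial.aeval (x 1) d := by
  simp [soloInformedBivEvalR, Polynomial.aeval_def]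

/-- Evaluation of the outer variable. -/
theorem soloInformed_bivEvalR_X (x : Fin 2 → ℝ) :
    soloInformedBivEvalR (K := K) x Polynomial.X = x 0 := by
  simp [soloInformedBivEvalR]

omit [Algebra K ℝ] in
/-- `Ψ (x₀) = X`. -/
theorem soloInformedBivΨ_X_zero : soloInformedBivΨ K (MvPolynomial.X 0) = Polynomial.X := by
  simp [soloInformedBivΨ, MvPolynomial.finSuccEquiv_X_zero, Polynomial.coe_mapAlgEquiv]

omit [Algebra K ℝ] in
/-- `Ψ (x₁) = C X`. -/
theorem soloInformedBivΨ_X_one :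
    soloInformedBivΨ K (MvPolynomial.X 1) = Polynomial.C Polynomial.X := by
  have h1 : (MvPolynomial.X 1 : MvPolynomial (Fin 2) K) = MvPolynomial.X (Fin.succ 0) := rfl
  rw [h1, soloInformedBivΨ, AlgEquiv.trans_apply, MvPolynomial.finSuccEquiv_X_succ,
    Polynomial.coe_mapAlgEquiv, Polynomial.map_C]
  congr 1
  simp [MvPolynomial.uniqueAlgEquiv_apply]

omit [Algebra K ℝ] in
/-- `Ψ (C a) = C (C a)`. -/
theorem soloInformedBivΨ_C (a : K) :
    soloInformedBivΨ K (MvPolynomial.C a) = Polynomial.C (Polynomial.C a) := by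
  rw [← MvPolynomial.algebraMap_eq, AlgEquiv.commutes, Polynomial.algebraMap_apply,
    Polynomial.algebraMap_eq]

/-- **The evaluation formula**: `F(x) = (Ψ F)(x₀)` with coefficients evaluated at `x₁`. -/
theorem soloInformed_bivEvalR_Ψ (x : Fin 2 → ℝ) (F : MvPolynomial (Fin 2) K) :
    soloInformedBivEvalR x (soloInformedBivΨ K F) = MvPolynomial.aeval x F := by
  induction F using MvPolynomial.induction_on with
  | C a =>
    rw [soloInformedBivΨ_C, soloInformed_bivEvalR_C, Polynomial.aeval_C, MvPolynomial.algHom_C]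
  | add p q hp hq => rw [map_add, map_add, map_add, hp, hq]
  | mul_X p i hp =>
    rw [map_mul, map_mul, map_mul, hp, MvPolynomial.aeval_X]
    congr 1
    fin_cases i
    · exact (congrArg _ soloInformedBivΨ_X_zero).trans (soloInformed_bivEvalR_X x)
    · refine (congrArg _ soloInformedBivΨ_X_one).trans ?_
      rw [soloInformed_bivEvalR_C, Polynomial.aeval_X]
      rfl

/-! ## ELIM -/

/-- **ELIM (second coordinate).**  `F` irreducible, `F ∤ G` `⇒` a non-zero `d ∈ K[t]` with
`d(x₁) = 0` at every common real zero `x` of `F` and `G`. [cite: BochnakCosteRoy1998, §1.2;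
Gauss's lemma] -/
theorem soloInformed_elim_snd {F G : MvPolynomial (Fin 2) K} (hF : Irreducible F)
    (hFG : ¬F ∣ G) :
    ∃ d : K[X], d ≠ 0 ∧ ∀ x : Fin 2 → ℝ, (MvPolynomial.aeval x F : ℝ) = 0 →
      (MvPolynomial.aeval x G : ℝ) = 0 → Polynomial.aeval (x 1) d = 0 := by
  classical
  have hfirr : Irreducible (soloInformedBivΨ K F) := (MulEquiv.irreducible_iff (soloInformedBivΨ K)).2 hF
  have hfg : ¬soloInformedBivΨ K F ∣ soloInformedBivΨ K G := fun h => hFG ((map_dvd_iff _).1 h)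
  have hg0 : soloInformedBivΨ K G ≠ 0 := fun h => hfg (h ▸ dvd_zero _)
  by_cases hdeg : (soloInformedBivΨ K F).natDegree = 0
  · refine ⟨(soloInformedBivΨ K F).coeff 0, fun h0 => hfirr.ne_zero ?_, fun x hxF _ => ?_⟩
    · rw [Polynomial.eq_C_of_natDegree_eq_zero hdeg, h0, map_zero]
    · rw [← soloInformed_bivEvalR_C x, ← Polynomial.eq_C_of_natDegree_eq_zero hdeg,
        soloInformed_bivEvalR_Ψ, hxF]
  -- Gauss's lemma over `R = K[x₁]`, `L = Frac R`
  let L := FractionRing K[X]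
  have hinj : Function.Injective (algebraMap K[X] L) := IsFractionRing.injective _ _
  have hfprim : (soloInformedBivΨ K F).IsPrimitive := hfirr.isPrimitive hdeg
  obtain ⟨p, q, -, -, hpq⟩ := Polynomial.exists_mul_add_mul_eq_C_resultant (soloInformedBivΨ K F)
    (soloInformedBivΨ K G) le_rfl le_rfl (Or.inl hdeg)
  refine ⟨Polynomial.resultant (soloInformedBivΨ K F) (soloInformedBivΨ K G), fun hd0 => ?_,
    fun x hxF hxG => ?_⟩
  · have hf' : Irreducible ((soloInformedBivΨ K F).map (algebraMap K[X] L)) :=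
      (hfprim.irreducible_iff_irreducible_map_fraction_map (K := L)).1 hfirr
    have hndvd : ¬(soloInformedBivΨ K F).map (algebraMap K[X] L) ∣
        (soloInformedBivΨ K G).map (algebraMap K[X] L) := by
      intro hdvd
      apply hfg
      have hgeq := (soloInformedBivΨ K G).eq_C_content_mul_primPart
      have hc0 : (soloInformedBivΨ K G).content ≠ 0 := by
        rwa [Ne, Polynomial.content_eq_zero_iff]
      have hu : IsUnit (Polynomial.C (algebraMap K[X] L (soloInformedBivΨ K G).content)) :=
        Polynomial.isUnit_C.2 (((map_ne_zero_iff _ hinj).2 hc0).isUnit)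
      have hdvd' : (soloInformedBivΨ K F).map (algebraMap K[X] L) ∣
          (soloInformedBivΨ K G).primPart.map (algebraMap K[X] L) := by
        rw [hgeq, Polynomial.map_mul, Polynomial.map_C] at hdvd
        exact hu.dvd_mul_left.1 hdvd
      exact (hfprim.dvd_of_fraction_map_dvd_fraction_map hdvd').trans
        (soloInformedBivΨ K G).primPart_dvd
    have hcop : IsCoprime ((soloInformedBivΨ K F).map (algebraMap K[X] L))
        ((soloInformedBivΨ K G).map (algebraMap K[X] L)) :=
      hf'.coprime_iff_not_dvd.2 hndvd
    have hres : Polynomial.resultant ((soloInformedBivΨ K F).map (algebraMap K[X] L))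
        ((soloInformedBivΨ K G).map (algebraMap K[X] L)) ≠ 0 := by
      rw [Ne, Polynomial.resultant_eq_zero_iff]
      exact fun h => h.2 hcop
    apply hres
    rw [Polynomial.natDegree_map_eq_of_injective hinj,
      Polynomial.natDegree_map_eq_of_injective hinj, Polynomial.resultant_map_map, hd0, map_zero]
  · have h := congrArg (soloInformedBivEvalR x) hpq
    rw [map_add, map_mul, map_mul, soloInformed_bivEvalR_Ψ, soloInformed_bivEvalR_Ψ, hxF, hxG,
      zero_mul, zero_mul, zero_add, soloInformed_bivEvalR_C] at h
    exact h.symm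

omit [Algebra K ℝ] in
/-- The swap as the algebra automorphism `renameEquiv`. -/
theorem soloInformed_swapK_eq_renameEquiv (P : MvPolynomial (Fin 2) K) :
    soloInformedSwapK P = MvPolynomial.renameEquiv K (Equiv.swap (0 : Fin 2) 1) P := rfl

/-- **ELIM (first coordinate).**  `F` irreducible, `F ∤ G` `⇒` a non-zero `d ∈ K[t]` with
`d(x₀) = 0` at every common real zero `x` of `F` and `G` (ELIM for the swapped polynomials).
[this work] -/
theorem soloInformed_elim_fst {F G : MvPolynomial (Fin 2) K} (hF : Irreducible F)
    (hFG : ¬F ∣ G) :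
    ∃ d : K[X], d ≠ 0 ∧ ∀ x : Fin 2 → ℝ, (MvPolynomial.aeval x F : ℝ) = 0 →
      (MvPolynomial.aeval x G : ℝ) = 0 → Polynomial.aeval (x 0) d = 0 := by
  have hF' : Irreducible (soloInformedSwapK F) := by
    rw [soloInformed_swapK_eq_renameEquiv]
    exact (MulEquiv.irreducible_iff _).2 hF
  have hFG' : ¬soloInformedSwapK F ∣ soloInformedSwapK G := by
    rw [soloInformed_swapK_eq_renameEquiv, soloInformed_swapK_eq_renameEquiv]
    exact fun h => hFG ((map_dvd_iff _).1 h)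
  obtain ⟨d, hd, h⟩ := soloInformed_elim_snd hF' hFG'
  refine ⟨d, hd, fun y hyF hyG => ?_⟩
  have h1 := h ![y 1, y 0]
  rw [soloInformed_aeval_swapK, soloInformed_aeval_swapK] at h1
  simp only [Matrix.cons_val_one, Matrix.cons_val_zero] at h1
  have hy : (![y 0, y 1] : Fin 2 → ℝ) = y := by
    funext j; fin_cases j <;> rfl
  rw [hy] at h1
  exact h1 hyF hyG

/-- **Common zeros of coprime plane curves are finite**: for `F` irreducible and `F ∤ G`, the
common real zero set of `F` and `G` is finite (it lies in the product of the root sets of the two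
eliminants). [cite: BochnakCosteRoy1998, §1.2] -/
theorem soloInformed_finite_commonZeros {F G : MvPolynomial (Fin 2) K} (hF : Irreducible F)
    (hFG : ¬F ∣ G) :
    {x : Fin 2 → ℝ | (MvPolynomial.aeval x F : ℝ) = 0 ∧ (MvPolynomial.aeval x G : ℝ) = 0}.Finite := by
  classical
  obtain ⟨d₀, hd₀, h₀⟩ := soloInformed_elim_fst hF hFG
  obtain ⟨d₁, hd₁, h₁⟩ := soloInformed_elim_snd hF hFG
  have hKinj : Function.Injective (algebraMap K ℝ) := (algebraMap K ℝ).injective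
  refine (Set.Finite.pi (t := ![d₀.rootSet ℝ, d₁.rootSet ℝ]) fun i => ?_).subset ?_
  · fin_cases i <;> exact Polynomial.rootSet_finite _ _
  · rintro x ⟨hxF, hxG⟩
    rw [Set.mem_univ_pi]
    intro i
    fin_cases i
    · simp only [Fin.zero_eta, Matrix.cons_val_zero]
      exact Polynomial.mem_rootSet'.2
        ⟨(Polynomial.map_ne_zero_iff hKinj).2 hd₀, h₀ x hxF hxG⟩
    · simp only [Fin.mk_one, Matrix.cons_val_one]
      exact Polynomial.mem_rootSet'.2
        ⟨(Polynomial.map_ne_zero_iff hKinj).2 hd₁, h₁ x hxF hxG⟩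

end Summit.KontsevichZagierPeriods.KontsevichZagierPeriods.Theorems
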